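import Literature.MathematicalPhysics.QuantumFieldTheory.Balaban1983to89.B9SectBGWordDRDY
import Literature.MathematicalPhysics.QuantumFieldTheory.Balaban1983to89.B9SectBGWordHessY
import Literature.MathematicalPhysics.QuantumFieldTheory.Balaban1983to89.Node00.OpsYCoarseBondRep
import Literature.MathematicalPhysics.QuantumFieldTheory.Balaban1983to89.Node00.OpsYGauge
import Literature.MathematicalPhysics.QuantumFieldTheory.Balaban1983to89.B9Eq386Neumann
import Literature.MathematicalPhysics.QuantumFieldTheory.Balaban1983to89.B9CoReadingCoords
import Literature.MathematicalPhysics.QuantumFieldTheory.Balaban1983to89.B9Cor36GpCubeEntriesAtV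

/-!
# Balaban [B9], (3.26) p. 395 — ★★★ NODE 00's `Δ_a(U)` (`Node00.deltaAY`) IS r06's `deltaA` WORD OF THE G FRAMES IN REAL BOND COORDINATES, FOR EVERY
# CONFIGURATION: the letters `QbC ∕ QsbC ∕ abC` (§1), the sign-blindness of the words in the constant `c_f` (§2), ★★★ `conj_deltaAY_eq` (§3) —
# DESIGN POINT 2 of the pub-ymgap N06 G-side plan (Route L), assembled; §4 the remaining bond letters of the G-frame instance (`GbC = G(V)`, `LapBC = Δ_V`,
# the (3.80) variations `F₂C ∕ F₂sC`) with the laws `reg_ginv` ∕ `gb_eq_cplx` ∕ `qb_mul` of `B9SectBGFrameV4.GFrame₄` discharged at the letters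

T. Bałaban, *Propagators for lattice gauge theories in a background field*, Commun. Math. Phys. **99** (1985) 389–434
[`Balaban1985BackgroundPropagators`, "B9"].

statement-level skeleton of published theorems with citation tags; proofs where landed; nothing here is a claim about the
Yang–Mills mass gap

THE PRINTED LOCUS (p. 395, (3.26)): *«Δ_a(U) = Δ(U) + D_U R(U) D*_U + Q*(U) a Q(U)»*, with (3.10) `Δ(U) = D*_U D_U + Δ′(U)` p. 392 and (3.25) `R(U)` p. 394.

WHY THIS FILE (seat dag-n06-c gen 13; G-SIDE-PLAN v2, Route L, L-4a).  The row-13 G frames (`B9SectBGFrameV4.GFrame₄` and its H1 ∕ E4–H2 children) state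
their laws (`reg_ginv`, `gb_eq_cplx`) for r06's word `deltaA (conj b (lapDDLetter T η⁻¹ V)) (conj b (dPrimeLetter T V η)) (conjHom b (gradLin T η⁻¹ V) ∘ (1 −
Gop∘Qcs∘Cop∘Qc∘Gop) ∘ conjHom b (divLin T η⁻¹ V)) Qsb ab Qb` (`B9Eq386Neumann.deltaA DsD Δp DRDs Qs a Q = DsD + Δp + DRDs + Qs·a·Q`).  NODE 00's operator is
`deltaAY parS parB Gp U = hessY U + gradY U ∘ RY ∘ divY U + QsY ∘ aY ∘ QY`, rewritten by node00-def-Y as a word in FINE-BOND endomorphisms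
(`Node00.OpsYCoarseBondRep.deltaAY_eq_fineBondWord`, letters `QbY ∕ QsbY ∕ abY`).  Gen 13's bricks identified the pieces: `B9SectBGWordHessY.bondFunCoordsY_hessY`
(`Δ(U)` ≡ `lapDDLetter |c_f| + dPrimeLetter |c_f|⁻¹`), `B9SectBGWordDRDY.conj_gradY_RY_divY_eq` (the middle word at coded configurations, with gen 12's site letters
`GopC ∕ QcsC ∕ CopC ∕ QcC`).  THIS FILE names the three bond letters in real coordinates — §1 `QbC parB b c := conj b (bondOpCoordsY (QbY parB (decY c)))`,
`QsbC`, `abC` (pattern of gen 12's `B9SectBKerLettersY.QcC`), with PRINT's split of the block volume between `Q*` and `a` (the frames' constants `κQb`,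
`ā` are uniform over members: node00-def-Y's plain transpose `QsY` and volume-carrying weight `aK = diagonal w` are rebalanced as `QsbVY := QsY∘diag(vol)∘res`,
`abVY := ext∘diag(w∕vol)∘res`, `vol(ι) = (L^{d+1})^{j(ι)}`, ★ `QsbVY_comp_abVY_comp_QbY`: the product is unchanged) — and assembles: §3 ★★★ `conj_deltaAY_eq` — for EVERY coded configuration `c` of the member,
`conj b (bondOpCoordsY (deltaAY parS parB (GpY parS) (decY c)))` IS r06's `deltaA` word at the charted background `UboxY (decY c)` with the constant
`|c_f|` (`= η⁻¹` of the frames' geometry `kGeo`) and the letters `GopC … QbC` at `c`.  §2 supplies the one non-definitional step: NODE 00's `gradY ∕ divY` carry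
the signed constant `c_f` (`B9SectBGWordGradDivY`), the frames `|c_f|`; the middle word is quadratic in the constant (`gradLin_neg`, `divLin_neg`,
`conjHom_neg`, ★ `middleWord_abs`), and `lapDDLetter c` depends on `c²` only.

§4 (for the instance `gFrame₄CodedOn`, L-5): `bondOpCoordsRY` (the `ℝ`-linear twin of def-Y's `bondOpCoordsY`), `GbC parS parB b c := conj b (bondOpCoordsY (GAY parS
parB (GpY parS) (decY c)))` ((3.27) `G = Δ_a⁻¹`, total), `LapBC b c` (def-Y's bond Laplacian `lapBₗ` of the fourth (3.42) entry), `F₂C ∕ F₂sC` ((3.80): `Q(U′U) − Q(U)` at a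
(base, multiplier) pair, `0` elsewhere — gen 12's `FcC` pattern); laws ★ `word_mul_GbC` ∕ `GbC_mul_word` (FIELD `reg_ginv`: at a decoded configuration where
`Δ_a` is a unit — displayed `hunitA` at G-valued bases — the frames' word times `GbC` is `1`, by §3), ★ `GbC_eq_of_two_sided` (FIELD `gb_eq_cplx`: any two-sided
inverse of the word IS `GbC`, and then `Δ_a` is a unit), `qbC_prod` ∕ `qsbC_prod` (FIELD `qb_mul`, by definition).

HONEST SCOPE.  Definitions (coordinate readings of node00-def-Y's letters) and exact finite-dimensional identities between DEFINED objects; no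
estimate ((3.15) ∕ (3.80)–(3.81) sizes of the Q letters are NOT here — L-4b); nothing of [B9] asserted; count-neutral; N06 NOT discharged; nothing continuum ∕ OS ∕ mass-gap ∕
Clay.  No `sorry`, no `axiom`, no `instance`, no `notation`.  `--supports stmt-QuantumFields-27364`.

RELATED IN THE TREE, NOT DUPLICATED: `Node00.OpsYCoarseBondRep` (def-Y: the fine-bond letters and `deltaAY_eq_fineBondWord` — USED), `B9SectBKerLettersY` ∕
`B9SectBGpLettersY` (gen 12: the site letters — USED), `B9SectBGWordGradDivY` ∕ `B9SectBGWordDRDY` ∕ `B9SectBGWordHessY` (gen 13 — USED), `B9SectBGFrameV4`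
(the consumer's word), `B9Eq386Neumann.deltaA` (r06 — USED).
-/

noncomputable section

namespace Literature.MathematicalPhysics.QuantumFieldTheory.Balaban1983to89.B9SectBGWordDeltaAY

open Literature.MathematicalPhysics.QuantumFieldTheory.Balaban1983to89
open Literature.MathematicalPhysics.QuantumFieldTheory.Balaban1983to89.B6KLevelCensusIndexV1 (KIdx)
open Literature.MathematicalPhysics.QuantumFieldTheory.Balaban1983to89.B9Eq39Adjoint (covD covDstar)
open Literature.MathematicalPhysics.QuantumFieldTheory.Balaban1983to89.B9Eq352DivFormLetters (conj coordEquiv)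
open Literature.MathematicalPhysics.QuantumFieldTheory.Balaban1983to89.B9Cor36GpCubeEntriesAtV (conj_add')
open Literature.MathematicalPhysics.QuantumFieldTheory.Balaban1983to89.B9Eq376POneLetters (conjHom conjHom_apply conjHom_comp conjHom_eq_conj gradLin divLin
  gradLin_apply divLin_apply)
open Literature.MathematicalPhysics.QuantumFieldTheory.Balaban1983to89.B9Eq372RemLetters (lapDDLetter)
open Literature.MathematicalPhysics.QuantumFieldTheory.Balaban1983to89.B9Eq382V3Letters (dPrimeLetter)
open Literature.MathematicalPhysics.QuantumFieldTheory.Balaban1983to89.B9Eq386Neumann (deltaA)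
open Literature.MathematicalPhysics.QuantumFieldTheory.Balaban1983to89.B9SectBCodedCarrier (CCfg)
open Literature.MathematicalPhysics.QuantumFieldTheory.Balaban1983to89.B9Eq360DeltaPrimeAY (AfldY)
open Literature.MathematicalPhysics.QuantumFieldTheory.Balaban1983to89.B9SectBGpLettersY (GopC decY conj_one)
open Literature.MathematicalPhysics.QuantumFieldTheory.Balaban1983to89.B9CoReadingCoords (lapBₗ)
open Literature.MathematicalPhysics.QuantumFieldTheory.Balaban1983to89.B9SectBKerLettersY (QcC QcsC CopC)
open Literature.MathematicalPhysics.QuantumFieldTheory.Balaban1983to89.B9SectBGWordDRDY (conj_gradY_RY_divY_eq)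
open Literature.MathematicalPhysics.QuantumFieldTheory.Balaban1983to89.B9SectBGWordHessY (bondFunCoordsY_hessY)
open Literature.MathematicalPhysics.QuantumFieldTheory.Balaban1983to89.Node00 (SiteY FBondY CfgY SiteParY BondParY UboxY shiftY gradY divY GpY RY hessY deltaAY
  QbY QsY QY aY aK liftMatY liftMatY_mul resBondY extBondY resBondY_comp_extBondY QsbY_comp_abY_comp_QbY GAY deltaAY_eq_fineBondWord deltaAY_mul_GAY
  GAY_mul_deltaAY bondFunCoordsY bondOpCoordsY bondOpCoordsY_apply bondOpCoordsY_one IBondY aK_eq_diagonal)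

variable {𝔸 : Type} [NormedRing 𝔸] [NormedAlgebra ℂ 𝔸] [CompleteSpace 𝔸]
variable {d ℓ : ℕ} {hd : 1 ≤ d + 1} {hL : Odd (ℓ + 1) ∧ 1 < ℓ + 1} {b₀ b₁ : ℝ}
variable (i : KIdx d ℓ hd hL b₀ b₁) (parS : SiteParY 𝔸 i) (parB : BondParY 𝔸 i) {ι : Type} [Fintype ι] (b : Module.Basis ι ℝ 𝔸)

/-! ## §1 The bond letters `Q(U)`, `Q*(U)`, `a` in real bond coordinates — print's split of the block volume -/

/-- **the block-volume factor of an index bond**: `vol(ι) = (L^{d+1})^{j(ι)}` (`L = ℓ + 1`, `j(ι)` the level of `ι ∈ 𝔅`; `d + 1` = print's `d`).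
[cite: Balaban1985BackgroundPropagators, (3.13) p.393, dictionary] -/
def volY (ι : IBondY i) : ℝ := ((((ℓ + 1 : ℕ) : ℝ)) ^ (d + 1)) ^ (ι.1.1 : ℕ)

omit [CompleteSpace 𝔸] [NormedAlgebra ℂ 𝔸] [NormedRing 𝔸] in
/-- `vol(ι) > 0`. [cite: Balaban1985BackgroundPropagators, (3.13) p.393, bookkeeping] -/
theorem volY_pos (ι : IBondY i) : 0 < volY i ι := by
  unfold volY; positivity

/-- **print's `Q*(V)` read on fine bonds** — the WEIGHTED adjoint `(Lʲη)^d η^{−d}·Qᵀ` of (3.13): node00-def-Y's plain transpose `QsY` (`qsK = qKᵀ`) times the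
block volume, read off the representatives: `QsbVY := QsY ∘ diag(vol) ∘ res`. [cite: Balaban1985BackgroundPropagators, (3.13) p.393, (3.26) p.395] -/
def QsbVY (U : CfgY 𝔸 i) : Module.End ℂ (FBondY i → 𝔸) :=
  QsY i parB U ∘ₗ liftMatY 𝔸 (Matrix.diagonal (volY i)) ∘ₗ resBondY i

/-- **print's weight `a` read on fine bonds** — `a_j(Lʲη)^{−2}` on level `j` ((3.24)∕(3.26)): node00-def-Y's weight `w` (which carries the block volume, `aK =
diagonal w`) divided by the volume, placed on the representatives: `abVY := ext ∘ diag(w ∕ vol) ∘ res`. [cite: Balaban1985BackgroundPropagators, (3.24) p.394, (3.26) p.395] -/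
def abVY : Module.End ℂ (FBondY i → 𝔸) :=
  extBondY i ∘ₗ liftMatY 𝔸 (Matrix.diagonal fun ι => i.w ι / volY i ι) ∘ₗ resBondY i

/-- ★ THE REBALANCED TRIPLE IS PRINT'S: `QsbVY ∘ abVY ∘ QbY = QsY ∘ aY ∘ QY` (`res ∘ ext = id`, `diag(vol)·diag(w∕vol) = diag(w) = aK`).
[cite: Balaban1985BackgroundPropagators, (3.26) p.395] -/
theorem QsbVY_comp_abVY_comp_QbY (U : CfgY 𝔸 i) : QsbVY i parB U ∘ₗ abVY i ∘ₗ QbY i parB U = QsY i parB U ∘ₗ aY i ∘ₗ QY i parB U := by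
  have hvol : Matrix.diagonal (volY i) * Matrix.diagonal (fun ι => i.w ι / volY i ι) = aK i := by
    rw [Matrix.diagonal_mul_diagonal, aK_eq_diagonal]
    congr 1; funext ι; rw [mul_div_cancel₀ _ (volY_pos i ι).ne']
  simp only [QsbVY, abVY, QbY, LinearMap.comp_assoc]
  rw [← LinearMap.comp_assoc (QY i parB U) (extBondY i) (resBondY i), resBondY_comp_extBondY, LinearMap.id_comp,
    ← LinearMap.comp_assoc (liftMatY 𝔸 (Matrix.diagonal fun ι => i.w ι / volY i ι) ∘ₗ QY i parB U) (extBondY i) (resBondY i),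
    resBondY_comp_extBondY, LinearMap.id_comp, ← LinearMap.comp_assoc (QY i parB U), ← liftMatY_mul, hvol]
  rfl

/-- ★ `Δ_a(U)` as a word in fine-bond endomorphisms with PRINT's split of the third term: `deltaAY = hessY + gradY∘RY∘divY + QsbVY∘abVY∘QbY`.
[cite: Balaban1985BackgroundPropagators, (3.26) p.395] -/
theorem deltaAY_eq_fineBondWordV (Gp : Node00.SiteOpY 𝔸 i) (U : CfgY 𝔸 i) :
    deltaAY i parS parB Gp U = hessY i U + gradY i U ∘ₗ RY i parS Gp U ∘ₗ divY i U + QsbVY i parB U ∘ₗ abVY i ∘ₗ QbY i parB U := by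
  rw [QsbVY_comp_abVY_comp_QbY]; rfl

/-- **the letter `Qb = Q(V)` read on fine bonds** ((3.12); node00-def-Y's `QbY = ext ∘ Q(V)`) in real bond coordinates, at every coded configuration (at its
decoding). [cite: Balaban1985BackgroundPropagators, (3.12) p.393, (3.26) p.395] -/
def QbC (c : CCfg (CfgY 𝔸 i) (AfldY 𝔸 i)) : Module.End ℝ ((Fin (d + 1) × SiteY i) × ι → ℝ) :=
  conj b ((bondOpCoordsY i (QbY i parB (decY i c))).restrictScalars ℝ)

/-- **the letter `Qsb = Q*(V)`** (print's weighted adjoint, `QsbVY`) in real bond coordinates. [cite: Balaban1985BackgroundPropagators, (3.13) p.393, (3.26) p.395] -/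
def QsbC (c : CCfg (CfgY 𝔸 i) (AfldY 𝔸 i)) : Module.End ℝ ((Fin (d + 1) × SiteY i) × ι → ℝ) :=
  conj b ((bondOpCoordsY i (QsbVY i parB (decY i c))).restrictScalars ℝ)

/-- **the weight letter `ab = a`** of (3.24)∕(3.26) (`abVY`) in real bond coordinates (configuration-independent). [cite: Balaban1985BackgroundPropagators, (3.24) p.394, (3.26) p.395] -/
def abC : Module.End ℝ ((Fin (d + 1) × SiteY i) × ι → ℝ) :=
  conj b ((bondOpCoordsY i (abVY (𝔸 := 𝔸) i)).restrictScalars ℝ)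

/-- `QbC` unfolded. [cite: Balaban1985BackgroundPropagators, (3.12) p.393, dictionary] -/
theorem QbC_def (c : CCfg (CfgY 𝔸 i) (AfldY 𝔸 i)) : QbC i parB b c = conj b ((bondOpCoordsY i (QbY i parB (decY i c))).restrictScalars ℝ) := rfl

/-- `QsbC` unfolded. [cite: Balaban1985BackgroundPropagators, (3.13) p.393, dictionary] -/
theorem QsbC_def (c : CCfg (CfgY 𝔸 i) (AfldY 𝔸 i)) : QsbC i parB b c = conj b ((bondOpCoordsY i (QsbVY i parB (decY i c))).restrictScalars ℝ) := rfl

omit [CompleteSpace 𝔸] in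
/-- `abC` unfolded. [cite: Balaban1985BackgroundPropagators, (3.26) p.395, dictionary] -/
theorem abC_def : abC (𝔸 := 𝔸) i b = conj b ((bondOpCoordsY i (abVY (𝔸 := 𝔸) i)).restrictScalars ℝ) := rfl

/-! ## §2 Bookkeeping: the words are blind to the sign of the constant (`conj b` adds: p38's `B9Cor36GpCubeEntriesAtV.conj_add'`) -/

omit [CompleteSpace 𝔸] in
/-- `conjHom b` commutes with negation. [folklore] [cite: Balaban1984PropagatorsII, (2.51) p.232, bookkeeping] -/
theorem conjHom_neg {X Y : Type} (L : (X → 𝔸) →ₗ[ℝ] (Y → 𝔸)) : conjHom b (-L) = -conjHom b L := by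
  refine LinearMap.ext fun μ => funext fun p => ?_
  simp only [conjHom_apply, LinearMap.neg_apply, Pi.neg_apply, map_neg, Finsupp.neg_apply]

/-- restriction of scalars of bond endomorphisms is multiplicative. [folklore] [cite: Balaban1985BackgroundPropagators, (3.26) p.395, bookkeeping] -/
theorem restrictScalars_mul' {M : Type} [AddCommGroup M] [Module ℂ M] (f g : Module.End ℂ M) :
    (f * g).restrictScalars ℝ = f.restrictScalars ℝ * g.restrictScalars ℝ := rfl

/-- restriction of scalars of bond endomorphisms is additive. [folklore] [cite: Balaban1985BackgroundPropagators, (3.26) p.395, bookkeeping] -/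
theorem restrictScalars_add' {M : Type} [AddCommGroup M] [Module ℂ M] (f g : Module.End ℂ M) :
    (f + g).restrictScalars ℝ = f.restrictScalars ℝ + g.restrictScalars ℝ := rfl

omit [CompleteSpace 𝔸] in
/-- `gradLin T (−c) V = −gradLin T c V`. [cite: Balaban1985BackgroundPropagators, (3.3) p.390, bookkeeping] -/
theorem gradLin_neg {κ S : Type} (T : κ → S ≃ S) (c : ℂ) (V : κ → S → 𝔸ˣ) : gradLin T (-c) V = -gradLin T c V := by
  refine LinearMap.ext fun f => funext fun p => ?_
  simp only [gradLin_apply, LinearMap.neg_apply, Pi.neg_apply, neg_smul]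

omit [CompleteSpace 𝔸] in
/-- `divLin T (−c) V = −divLin T c V`. [cite: Balaban1985BackgroundPropagators, (3.8) p.392, bookkeeping] -/
theorem divLin_neg {κ S : Type} [Fintype κ] (T : κ → S ≃ S) (c : ℂ) (V : κ → S → 𝔸ˣ) : divLin T (-c) V = -divLin T c V := by
  refine LinearMap.ext fun F => funext fun x => ?_
  simp only [divLin_apply, LinearMap.neg_apply, Pi.neg_apply, neg_smul]

omit [CompleteSpace 𝔸] in
/-- ★ the middle word `conjHom b (gradLin T c V) ∘ M ∘ conjHom b (divLin T c V)` is blind to the sign of the real constant: `c` may be replaced by `|c|`.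
[cite: Balaban1985BackgroundPropagators, (3.26) p.395, bookkeeping] -/
theorem middleWord_abs {κ S : Type} [Fintype κ] (T : κ → S ≃ S) (c : ℝ) (V : κ → S → 𝔸ˣ) (M : Module.End ℝ (S × ι → ℝ)) :
    conjHom b (gradLin T ((|c| : ℝ) : ℂ) V) ∘ₗ M ∘ₗ conjHom b (divLin T ((|c| : ℝ) : ℂ) V) =
      conjHom b (gradLin T ((c : ℝ) : ℂ) V) ∘ₗ M ∘ₗ conjHom b (divLin T ((c : ℝ) : ℂ) V) := by
  rcases le_or_gt 0 c with hc | hc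
  · rw [abs_of_nonneg hc]
  · rw [abs_of_neg hc, Complex.ofReal_neg, gradLin_neg, divLin_neg, conjHom_neg, conjHom_neg, LinearMap.neg_comp, LinearMap.comp_neg,
      LinearMap.comp_neg, neg_neg]

omit [CompleteSpace 𝔸] in
/-- `lapDDLetter T c V` depends on `c²` only: `c` may be replaced by `|c|`. [cite: Balaban1985BackgroundPropagators, (3.10) p.392, bookkeeping] -/
theorem lapDDLetter_abs {κ S : Type} [Fintype κ] [DecidableEq κ] (T : κ → S ≃ S) (c : ℝ) (V : κ → S → 𝔸ˣ) :
    lapDDLetter T ((|c| : ℝ) : ℂ) V = lapDDLetter T ((c : ℝ) : ℂ) V := by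
  have h : (((|c| : ℝ) : ℂ)) ^ 2 = ((c : ℝ) : ℂ) ^ 2 := by rw [← Complex.ofReal_pow, ← Complex.ofReal_pow, sq_abs]
  simp only [lapDDLetter, h]

/-! ## §3 ★★★ `Δ_a(U)` is the frames' word -/

/-- NODE 00's Hessian as an OPERATOR identity in bond coordinates: `bondOpCoordsY (hessY U) = lapDDLetter (shiftY) |c_f| (UboxY U) + dPrimeLetter (shiftY) (UboxY U) |c_f|⁻¹`
(realified). [cite: Balaban1985BackgroundPropagators, (3.10) p.392] -/
theorem bondOpCoordsY_hessY (U : CfgY 𝔸 i) :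
    (bondOpCoordsY i (hessY i U)).restrictScalars ℝ =
      lapDDLetter (shiftY i) ((|i.cf| : ℝ) : ℂ) (UboxY i U) + dPrimeLetter (shiftY i) (UboxY i U) (|i.cf|⁻¹) := by
  refine LinearMap.ext fun F => ?_
  rw [LinearMap.restrictScalars_apply, bondOpCoordsY_apply, bondFunCoordsY_hessY, LinearEquiv.apply_symm_apply, LinearMap.add_apply]

/-- the middle term as an operator identity in bond coordinates (coded configurations, gen 12's site letters), with the constant `|c_f|`.
[cite: Balaban1985BackgroundPropagators, (3.25)–(3.26) pp.394–395] -/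
theorem conj_bondOpCoordsY_gradY_RY_divY (c : CCfg (CfgY 𝔸 i) (AfldY 𝔸 i)) :
    conj b ((bondOpCoordsY i (gradY i (decY i c) ∘ₗ RY i parS (GpY i parS) (decY i c) ∘ₗ divY i (decY i c))).restrictScalars ℝ) =
      conjHom b (gradLin (shiftY i) ((|i.cf| : ℝ) : ℂ) (UboxY i (decY i c))) ∘ₗ
        (1 - GopC i parS b c ∘ₗ QcsC i parS b c ∘ₗ CopC i parS b c ∘ₗ QcC i parS b c ∘ₗ GopC i parS b c) ∘ₗ
        conjHom b (divLin (shiftY i) ((|i.cf| : ℝ) : ℂ) (UboxY i (decY i c))) := by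
  rw [middleWord_abs, ← conj_gradY_RY_divY_eq]
  congr 1

/-- ★★★ **DESIGN POINT 2 — NODE 00's `Δ_a(U)` IS THE G FRAMES' `deltaA` WORD**: for every coded configuration `c` of the member (real basis `b` of `𝔸`,
transporters `parS`, averaging data `parB`), in real bond coordinates
`conj b (bondOpCoordsY (deltaAY parS parB (GpY parS) (decY c))) = deltaA (conj b (lapDDLetter (shiftY) |c_f| V)) (conj b (dPrimeLetter (shiftY) V |c_f|⁻¹))
(conjHom b (gradLin (shiftY) |c_f| V) ∘ (1 − GopC c∘QcsC c∘CopC c∘QcC c∘GopC c) ∘ conjHom b (divLin (shiftY) |c_f| V)) (QsbC c) abC (QbC c)`, `V := UboxY (decY c)` —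
r06's (3.26)∕(3.82) word with the frames' constant `η⁻¹ = |c_f|`. [cite: Balaban1985BackgroundPropagators, (3.26) p.395, (3.10) p.392, (3.25) p.394] -/
theorem conj_deltaAY_eq (c : CCfg (CfgY 𝔸 i) (AfldY 𝔸 i)) :
    conj b ((bondOpCoordsY i (deltaAY i parS parB (GpY i parS) (decY i c))).restrictScalars ℝ) =
      deltaA (conj b (lapDDLetter (shiftY i) ((|i.cf| : ℝ) : ℂ) (UboxY i (decY i c))))
        (conj b (dPrimeLetter (shiftY i) (UboxY i (decY i c)) (|i.cf|⁻¹)))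
        (conjHom b (gradLin (shiftY i) ((|i.cf| : ℝ) : ℂ) (UboxY i (decY i c))) ∘ₗ
            (1 - GopC i parS b c ∘ₗ QcsC i parS b c ∘ₗ CopC i parS b c ∘ₗ QcC i parS b c ∘ₗ GopC i parS b c) ∘ₗ
          conjHom b (divLin (shiftY i) ((|i.cf| : ℝ) : ℂ) (UboxY i (decY i c))))
        (QsbC i parB b c) (abC i b) (QbC i parB b c) := by
  rw [deltaAY_eq_fineBondWordV, deltaA, ← conj_bondOpCoordsY_gradY_RY_divY, QsbC, abC, QbC]
  have hC : bondOpCoordsY i (QsbVY i parB (decY i c) ∘ₗ abVY i ∘ₗ QbY i parB (decY i c)) =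
      bondOpCoordsY i (QsbVY i parB (decY i c)) * (bondOpCoordsY i (abVY i) * bondOpCoordsY i (QbY i parB (decY i c))) := by
    rw [← Node00.bondOpCoordsY_mul, ← Node00.bondOpCoordsY_mul]; rfl
  rw [map_add, map_add, hC, restrictScalars_add', restrictScalars_add', restrictScalars_mul', restrictScalars_mul', conj_add', conj_add',
    B9Eq352DivFormLetters.conj_mul, B9Eq352DivFormLetters.conj_mul, bondOpCoordsY_hessY, conj_add', mul_assoc]


/-! ## §4 The remaining bond letters of the G-frame instance and their definitional laws -/

/-- the `ℝ`-linear twin of def-Y's `bondOpCoordsY`: conjugation of `ℝ`-linear bond endomorphisms by the coordinate change `bondFunCoordsY`.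
[cite: Balaban1985BackgroundPropagators, (3.4)–(3.9) pp.391–392, dictionary] -/
def bondOpCoordsRY : Module.End ℝ (FBondY i → 𝔸) ≃ₗ[ℝ] Module.End ℝ (Fin (d + 1) × SiteY i → 𝔸) :=
  ((bondFunCoordsY (𝔸 := 𝔸) i).restrictScalars ℝ).conj

omit [CompleteSpace 𝔸] in
/-- the conjugation formula. [cite: Balaban1985BackgroundPropagators, (3.4)–(3.9) pp.391–392, dictionary] -/
theorem bondOpCoordsRY_apply (f : Module.End ℝ (FBondY i → 𝔸)) (g : Fin (d + 1) × SiteY i → 𝔸) :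
    bondOpCoordsRY i f g = bondFunCoordsY i (f ((bondFunCoordsY i).symm g)) := by
  simp [bondOpCoordsRY, LinearEquiv.conj_apply]

omit [CompleteSpace 𝔸] in
/-- the `ℝ`-twin extends `bondOpCoordsY`: `(bondOpCoordsY f)|_ℝ = bondOpCoordsRY (f|_ℝ)`. [cite: Balaban1985BackgroundPropagators, (3.4)–(3.9) pp.391–392, bookkeeping] -/
theorem restrictScalars_bondOpCoordsY (f : Module.End ℂ (FBondY i → 𝔸)) :
    (bondOpCoordsY i f).restrictScalars ℝ = bondOpCoordsRY i (f.restrictScalars ℝ) := by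
  refine LinearMap.ext fun g => ?_
  rw [LinearMap.restrictScalars_apply, bondOpCoordsY_apply, bondOpCoordsRY_apply, LinearMap.restrictScalars_apply]

/-- **the letter `Gb = G(V) = Δ_a(V)⁻¹`** ((3.27); node00-def-Y's total `GAY = Ring.inverse Δ_a`) in real bond coordinates, at every coded configuration.
[cite: Balaban1985BackgroundPropagators, (3.27) p.395, Thm 3.3 p.399] -/
def GbC (c : CCfg (CfgY 𝔸 i) (AfldY 𝔸 i)) : Module.End ℝ ((Fin (d + 1) × SiteY i) × ι → ℝ) :=
  conj b ((bondOpCoordsY i (GAY i parS parB (GpY i parS) (decY i c))).restrictScalars ℝ)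

/-- **the bond Laplacian letter `LapB = Δ_V = Σ_μ ∇*_{V,μ}∇_{V,μ}`** of the fourth (3.42) entry (node00-def-Y's `lapBₗ`) in real bond coordinates.
[cite: Balaban1985BackgroundPropagators, (3.42) p.397] -/
def LapBC (c : CCfg (CfgY 𝔸 i) (AfldY 𝔸 i)) : Module.End ℝ ((Fin (d + 1) × SiteY i) × ι → ℝ) :=
  conj b (bondOpCoordsRY i (lapBₗ i (decY i c)))

/-- **the (3.80) variation letter `F₂(A) = Q(U′U) − Q(U)`** at a (base `U`, multiplier `a`) pair, `0` at every other pair (gen 12's `FcC` pattern).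
[cite: Balaban1985BackgroundPropagators, (3.80) p.406] -/
def F₂C : CCfg (CfgY 𝔸 i) (AfldY 𝔸 i) → CCfg (CfgY 𝔸 i) (AfldY 𝔸 i) → Module.End ℝ ((Fin (d + 1) × SiteY i) × ι → ℝ)
  | .base U, .mult a => QbC i parB b (.prod U a) - QbC i parB b (.base U)
  | _, _ => 0

/-- **the (3.80) variation letter `F₂*(A) = Q*(U′U) − Q*(U)`** at a (base, multiplier) pair, `0` elsewhere. [cite: Balaban1985BackgroundPropagators, (3.80) p.406] -/
def F₂sC : CCfg (CfgY 𝔸 i) (AfldY 𝔸 i) → CCfg (CfgY 𝔸 i) (AfldY 𝔸 i) → Module.End ℝ ((Fin (d + 1) × SiteY i) × ι → ℝ)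
  | .base U, .mult a => QsbC i parB b (.prod U a) - QsbC i parB b (.base U)
  | _, _ => 0

/-- FIELD `qb_mul`, first half: `Q(e^{iηa}U) = Q(U) + F₂(a)` (by definition of `F₂C`). [cite: Balaban1985BackgroundPropagators, (3.80) p.406] -/
theorem qbC_prod (U : CfgY 𝔸 i) (a : AfldY 𝔸 i) : QbC i parB b (.prod U a) = QbC i parB b (.base U) + F₂C i parB b (.base U) (.mult a) := by
  simp only [F₂C, add_sub_cancel]

/-- FIELD `qb_mul`, second half: `Q*(e^{iηa}U) = Q*(U) + F₂*(a)`. [cite: Balaban1985BackgroundPropagators, (3.80) p.406] -/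
theorem qsbC_prod (U : CfgY 𝔸 i) (a : AfldY 𝔸 i) : QsbC i parB b (.prod U a) = QsbC i parB b (.base U) + F₂sC i parB b (.base U) (.mult a) := by
  simp only [F₂sC, add_sub_cancel]

/-- `Δ_a · G = 1` in real bond coordinates wherever `Δ_a` is a unit. [cite: Balaban1985BackgroundPropagators, (3.27) p.395] -/
theorem conj_deltaAY_mul_GbC (c : CCfg (CfgY 𝔸 i) (AfldY 𝔸 i)) (hU : IsUnit (deltaAY i parS parB (GpY i parS) (decY i c))) :
    conj b ((bondOpCoordsY i (deltaAY i parS parB (GpY i parS) (decY i c))).restrictScalars ℝ) * GbC i parS parB b c = 1 := by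
  rw [GbC, ← B9Eq352DivFormLetters.conj_mul, ← restrictScalars_mul', ← Node00.bondOpCoordsY_mul, deltaAY_mul_GAY i hU, bondOpCoordsY_one]
  exact conj_one b

/-- `G · Δ_a = 1` in real bond coordinates wherever `Δ_a` is a unit. [cite: Balaban1985BackgroundPropagators, (3.27) p.395] -/
theorem GbC_mul_conj_deltaAY (c : CCfg (CfgY 𝔸 i) (AfldY 𝔸 i)) (hU : IsUnit (deltaAY i parS parB (GpY i parS) (decY i c))) :
    GbC i parS parB b c * conj b ((bondOpCoordsY i (deltaAY i parS parB (GpY i parS) (decY i c))).restrictScalars ℝ) = 1 := by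
  rw [GbC, ← B9Eq352DivFormLetters.conj_mul, ← restrictScalars_mul', ← Node00.bondOpCoordsY_mul, GAY_mul_deltaAY i hU, bondOpCoordsY_one]
  exact conj_one b

/-- ★ FIELD `reg_ginv` AT THE LETTERS: wherever `Δ_a(decY c)` is a unit (displayed at (3.35)-regular G-valued bases: Thm 3.1's regime), the frames' `deltaA`
word times `GbC c` is `1` on both sides. [cite: Balaban1985BackgroundPropagators, (3.27) p.395, Thm 3.3 p.399] -/
theorem word_mul_GbC (c : CCfg (CfgY 𝔸 i) (AfldY 𝔸 i)) (hU : IsUnit (deltaAY i parS parB (GpY i parS) (decY i c))) :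
    deltaA (conj b (lapDDLetter (shiftY i) ((|i.cf| : ℝ) : ℂ) (UboxY i (decY i c))))
        (conj b (dPrimeLetter (shiftY i) (UboxY i (decY i c)) (|i.cf|⁻¹)))
        (conjHom b (gradLin (shiftY i) ((|i.cf| : ℝ) : ℂ) (UboxY i (decY i c))) ∘ₗ
            (1 - GopC i parS b c ∘ₗ QcsC i parS b c ∘ₗ CopC i parS b c ∘ₗ QcC i parS b c ∘ₗ GopC i parS b c) ∘ₗ
          conjHom b (divLin (shiftY i) ((|i.cf| : ℝ) : ℂ) (UboxY i (decY i c))))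
        (QsbC i parB b c) (abC i b) (QbC i parB b c) * GbC i parS parB b c = 1 ∧
    GbC i parS parB b c * deltaA (conj b (lapDDLetter (shiftY i) ((|i.cf| : ℝ) : ℂ) (UboxY i (decY i c))))
        (conj b (dPrimeLetter (shiftY i) (UboxY i (decY i c)) (|i.cf|⁻¹)))
        (conjHom b (gradLin (shiftY i) ((|i.cf| : ℝ) : ℂ) (UboxY i (decY i c))) ∘ₗ
            (1 - GopC i parS b c ∘ₗ QcsC i parS b c ∘ₗ CopC i parS b c ∘ₗ QcC i parS b c ∘ₗ GopC i parS b c) ∘ₗ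
          conjHom b (divLin (shiftY i) ((|i.cf| : ℝ) : ℂ) (UboxY i (decY i c))))
        (QsbC i parB b c) (abC i b) (QbC i parB b c) = 1 := by
  rw [← conj_deltaAY_eq]
  exact ⟨conj_deltaAY_mul_GbC i parS parB b c hU, GbC_mul_conj_deltaAY i parS parB b c hU⟩

/-- ★ FIELD `gb_eq_cplx` AT THE LETTERS: if the frames' `deltaA` word at `decY c` has a two-sided inverse `X`, then `Δ_a(decY c)` IS a unit and `GbC c = X` —
«its inverse again by G» ((3.27)∕(3.86)): the word is `Δ_a` in coordinates (§3), a bijection; units of `Module.End` are the bijections; inverses are unique.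
[cite: Balaban1985BackgroundPropagators, (3.27) p.395, (3.86) p.407] -/
theorem GbC_eq_of_two_sided (c : CCfg (CfgY 𝔸 i) (AfldY 𝔸 i)) (X : Module.End ℝ ((Fin (d + 1) × SiteY i) × ι → ℝ))
    (hDX : deltaA (conj b (lapDDLetter (shiftY i) ((|i.cf| : ℝ) : ℂ) (UboxY i (decY i c))))
        (conj b (dPrimeLetter (shiftY i) (UboxY i (decY i c)) (|i.cf|⁻¹)))
        (conjHom b (gradLin (shiftY i) ((|i.cf| : ℝ) : ℂ) (UboxY i (decY i c))) ∘ₗ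
            (1 - GopC i parS b c ∘ₗ QcsC i parS b c ∘ₗ CopC i parS b c ∘ₗ QcC i parS b c ∘ₗ GopC i parS b c) ∘ₗ
          conjHom b (divLin (shiftY i) ((|i.cf| : ℝ) : ℂ) (UboxY i (decY i c))))
        (QsbC i parB b c) (abC i b) (QbC i parB b c) * X = 1)
    (hXD : X * deltaA (conj b (lapDDLetter (shiftY i) ((|i.cf| : ℝ) : ℂ) (UboxY i (decY i c))))
        (conj b (dPrimeLetter (shiftY i) (UboxY i (decY i c)) (|i.cf|⁻¹)))
        (conjHom b (gradLin (shiftY i) ((|i.cf| : ℝ) : ℂ) (UboxY i (decY i c))) ∘ₗ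
            (1 - GopC i parS b c ∘ₗ QcsC i parS b c ∘ₗ CopC i parS b c ∘ₗ QcC i parS b c ∘ₗ GopC i parS b c) ∘ₗ
          conjHom b (divLin (shiftY i) ((|i.cf| : ℝ) : ℂ) (UboxY i (decY i c))))
        (QsbC i parB b c) (abC i b) (QbC i parB b c) = 1) :
    IsUnit (deltaAY i parS parB (GpY i parS) (decY i c)) ∧ GbC i parS parB b c = X := by
  rw [← conj_deltaAY_eq] at hDX hXD
  set D := conj b ((bondOpCoordsY i (deltaAY i parS parB (GpY i parS) (decY i c))).restrictScalars ℝ) with hD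
  -- `D` is bijective, hence so is `Δ_a(decY c)`: the same function conjugated by the two coordinate changes
  have hbijD : Function.Bijective D := (Module.End.isUnit_iff D).1 ⟨⟨D, X, hDX, hXD⟩, rfl⟩
  have hTe : ((deltaAY i parS parB (GpY i parS) (decY i c)) : (FBondY i → 𝔸) → (FBondY i → 𝔸)) =
      (bondFunCoordsY i).symm ∘ (coordEquiv b).symm ∘ D ∘ (coordEquiv b) ∘ (bondFunCoordsY i) := by
    funext f
    simp only [hD, Function.comp_apply, B9Eq352DivFormLetters.conj, LinearEquiv.conj_apply, LinearEquiv.coe_coe, LinearMap.comp_apply,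
      LinearEquiv.symm_apply_apply, LinearMap.restrictScalars_apply, bondOpCoordsY_apply]
  have hbijΔ : Function.Bijective (deltaAY i parS parB (GpY i parS) (decY i c)) := by
    rw [hTe]
    exact (bondFunCoordsY i).symm.bijective.comp ((coordEquiv b).symm.bijective.comp (hbijD.comp
      ((coordEquiv b).bijective.comp (bondFunCoordsY i).bijective)))
  have hunit : IsUnit (deltaAY i parS parB (GpY i parS) (decY i c)) := (Module.End.isUnit_iff _).2 hbijΔ
  refine ⟨hunit, ?_⟩
  have h1 : D * GbC i parS parB b c = 1 := conj_deltaAY_mul_GbC i parS parB b c hunit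
  calc GbC i parS parB b c = (X * D) * GbC i parS parB b c := by rw [hXD, one_mul]
    _ = X * (D * GbC i parS parB b c) := by rw [mul_assoc]
    _ = X := by rw [h1, mul_one]

end Literature.MathematicalPhysics.QuantumFieldTheory.Balaban1983to89.B9SectBGWordDeltaAY

end
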